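import Summits.ResolutionOfSingularities.ResolutionOfSingularities.Theorems.DecompositionDescentLU4
import HarnessLib

/-!
# DecompositionDescentLU (5/7) — `RelLU` places lie in the witness cell; the cut of the located residual off BOTH
decomposition cells; ROOT BY NAME

Part 5 of the g27 node `DecompositionDescentLU` of the ROOT/RESIDUAL decomposition cell `decomp-res`
(lens 1, window (W-dec) of critic rows 178/193/202); see the module docstring of
`Summits.ResolutionOfSingularities.ResolutionOfSingularities.Theorems.DecompositionDescentLU` (part 1/7)
for the thesis, the three layers of [CossartPiltant2008, Prop. 9.3], the two currencies of the decomposition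
cell (structure: `DecompositionFieldLUAbove`; witnesses: `DecWitnessLUAbove`), the laws, the residual R27, the
cut and the sources.  Problem side, sorry-free, hypothesis-free.

This part: `decWitnessLUAbove_of_relLU` (said openly: `K′ = K`, `x′ = ∅`), the decided cell pieces
`NonKHToricArchLUKeyHenselDescentQuotDecCell` / `…DecWCell` (`_holds`), the located residual R27
`NonKHToricArchLUKeyHenselDescentQuotDec` (off both cells; docstring names the unmatched residue clauses), the exact
cuts `…Quot_iff_dec : R25 ↔ R27`, `nonKHToricArchLUKeyHenselDescent_iff_dec : R23 ↔ R27`, `nonKHToricArchLU_iff_dec`,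
`…Dec_of_root`, `closes_dec` (the summit by name) and `root_iff_dec_sigma`.
-/

noncomputable section

open IsLocalRing IntermediateField Polynomial Literature.AlgebraicGeometry.Resolution
open scoped Pointwise

namespace Summit.ResolutionOfSingularities.ResolutionOfSingularities.Theorems.DecompositionDescentLU

universe u

section Law3

variable {k K : Type} [Field k] [Field K] [Algebra k K]

/-! ### E6. Said openly: places uniformizable below lie in the witness cell (`K′ = K`, `x′ = ∅`) -/

/-- **Said openly (row 202 probe): with NO witnesses the cell is literally `RelLU` — every place uniformizable
below lies in the witness cell (`K′ = K`, `x′ = ∅`, `t` = the regular model).**  The content of the law is the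
genuine tops. [folklore] -/
theorem decWitnessLUAbove_of_relLU {O : ValuationSubring K} (h : RelLocalUniformization k K O) :
    DecWitnessLUAbove k O := by
  classical
  let L := AlgebraicClosure K
  let ι : K →+* L := algebraMap K L
  have hιinj : Function.Injective ι := (algebraMap K L).injective
  let φ : K →ₐ[k] L := IsScalarTower.toAlgHom k K L
  obtain ⟨OE, hOE⟩ := exists_valuationSubring_comap_eq (Ω := L) O
  have hmemO : ∀ x : K, x ∈ O ↔ ι x ∈ OE := fun x => by
    rw [← hOE]; rfl
  have hvalO : ∀ y : K, O.valuation y < 1 ↔ OE.valuation (ι y) < 1 := fun y => by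
    rw [← valuation_comap_lt_one_iff OE ι y, hOE]
  haveI : Algebra.IsSeparable K (⊥ : IntermediateField K L) :=
    AlgEquiv.Algebra.isSeparable (IntermediateField.botEquiv K L).symm
  refine ⟨OE, hOE, ⊥, inferInstance, inferInstance, fun R hRfg hRfrac hRO => ?_⟩
  obtain ⟨A, hAO, hRA, ⟨tA, htA⟩, hregA⟩ := h R hRfg hRfrac hRO
  refine ⟨tA, fun x hx => hAO (by rw [← htA]; exact Algebra.subset_adjoin hx), ∅, by simp,
    fun x hx => by simp at hx, ?_⟩
  -- the upstairs model is `A` read in `L`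
  have hA : Algebra.adjoin k ((R : Set K) ∪ (tA : Set K)) = A := by
    apply le_antisymm
    · exact Algebra.adjoin_le (Set.union_subset (fun x hx => hRA hx)
        (fun x hx => by rw [← htA]; exact Algebra.subset_adjoin hx))
    · rw [← htA]; exact Algebra.adjoin_mono Set.subset_union_right
  have hAeq : Algebra.adjoin k (ι '' ((R : Set K) ∪ (tA : Set K)) ∪ ((∅ : Finset L) : Set L)) = A.map φ := by
    rw [Finset.coe_empty, Set.union_empty, ← hA, AlgHom.map_adjoin]; rfl
  rw [hAeq]
  have hA'O : (A.map φ).toSubring ≤ OE.toSubring := by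
    intro y hy
    obtain ⟨x, hx, rfl⟩ := Subalgebra.mem_map.mp hy
    exact (hmemO x).mp (hAO hx)
  rw [isRegularLocalRing_locAtCentre_iff hA'O]
  have hT : A.toSubring.map ι = (A.map φ).toSubring := by
    ext y
    rw [Subring.mem_map]
    constructor
    · rintro ⟨x, hx, rfl⟩; exact Subalgebra.mem_map.mpr ⟨x, hx, rfl⟩
    · intro hy
      obtain ⟨x, hx, rfl⟩ := Subalgebra.mem_map.mp hy
      exact ⟨x, hx, rfl⟩
  let g : A.toSubring ≃+* (A.map φ).toSubring :=
    (A.toSubring.equivMapOfInjective ι hιinj).trans (RingEquiv.subringCongr hT)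
  have hg : ∀ x : A.toSubring, ((g x : (A.map φ).toSubring) : L) = ι x := fun _ => rfl
  set P : Ideal A.toSubring := Ideal.comap (Subring.inclusion hAO) (IsLocalRing.maximalIdeal O) with hP
  set P' : Ideal (A.map φ).toSubring :=
    Ideal.comap (Subring.inclusion hA'O) (IsLocalRing.maximalIdeal OE) with hP'
  haveI : P'.IsPrime := Ideal.IsPrime.comap _
  haveI : P.IsPrime := Ideal.IsPrime.comap _
  haveI hregP : IsRegularLocalRing (Localization.AtPrime P) := hregA
  have hPP' : P = P'.comap g.toRingHom := by
    ext x
    simp only [hP, hP', Ideal.mem_comap, RingEquiv.toRingHom_eq_coe, RingHom.coe_coe]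
    rw [ValuationSubring.valuation_lt_one_iff, ValuationSubring.valuation_lt_one_iff]
    change O.valuation (x : K) < 1 ↔ OE.valuation ((g x : (A.map φ).toSubring) : L) < 1
    rw [hg]
    exact hvalO x
  have hmap : Submonoid.map g.toRingHom.toMonoidHom P.primeCompl = P'.primeCompl := by
    ext y
    constructor
    · rintro ⟨x, hx, rfl⟩
      change g x ∉ P'
      have hx' : x ∉ P := hx
      rw [hPP', Ideal.mem_comap] at hx'
      exact hx'
    · intro hy
      have hy' : y ∉ P' := hy
      refine ⟨g.symm y, ?_, ?_⟩
      · change g.symm y ∉ P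
        rw [hPP', Ideal.mem_comap]
        change ¬ g (g.symm y) ∈ P'
        rw [g.apply_symm_apply]
        exact hy'
      · change g (g.symm y) = y
        exact g.apply_symm_apply y
  change IsRegularLocalRing (Localization.AtPrime P')
  exact IsRegularLocalRing.of_ringEquiv (R := Localization.AtPrime P)
    (IsLocalization.ringEquivOfRingEquiv (Localization.AtPrime P) (Localization.AtPrime P') g hmap)

end Law3

/-! ## PART C — the located residual re-cut: `R25 ↔ R27` (exact, hypothesis-free; BOTH decomposition cells —
structure currency `DecompositionFieldLUAbove` and witness currency `DecWitnessLUAbove` — are consumed) and the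
ROOT BY NAME -/

section Cut

open Summit.ResolutionOfSingularities.ResolutionOfSingularities.Theses
open Summit.ResolutionOfSingularities.ResolutionOfSingularities.Theorems
open Summit.ResolutionOfSingularities.ResolutionOfSingularities.Theorems.KeyChainLU
open Summit.ResolutionOfSingularities.ResolutionOfSingularities.Theorems.HenselKeyChainLU
open Summit.ResolutionOfSingularities.ResolutionOfSingularities.Theorems.GaloisDescentLU
open Summit.ResolutionOfSingularities.ResolutionOfSingularities.Theorems.PfaffLine
open Summit.ResolutionOfSingularities.ResolutionOfSingularities.Theorems.ToricLadder
open Summit.ResolutionOfSingularities.ResolutionOfSingularities.Theorems.KaplanskyLadder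
open Summit.ResolutionOfSingularities.ResolutionOfSingularities.Theorems.PerronLadder
open Summit.ResolutionOfSingularities.ResolutionOfSingularities.Theorems.DefectlessLadder
open Summit.ResolutionOfSingularities.ResolutionOfSingularities.Theorems.WCut
open Summit.ResolutionOfSingularities.ResolutionOfSingularities.Theorems.TameQuotientLU

/-- **DECIDED PIECE** (tag DECIDED — a kernel THEOREM, `nonKHToricArchLUKeyHenselDescentQuotDecCell_holds`; WEAKER
than the root; located at `(e, c, n) = (3, 3, 4)`): the located residual of g25 (`TameQuotientLU…Quot`: off the
key-chain, Hensel, descent and tame-quotient cells) restricted to the DECOMPOSITION-DESCENT CELL. -/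
def NonKHToricArchLUKeyHenselDescentQuotDecCell (e c n : ℕ) : Prop :=
  ∀ p : ℕ, p.Prime → ∀ (k K : Type) [Field k] [CharP k p] [Field K] [Algebra k K],
    Algebra.trdeg k K ≤ n → ∀ O : ValuationSubring K, Nonempty O.valuation.RankOne →
    (∀ y ∈ O, ∃ f : Polynomial k, f ≠ 0 ∧ Polynomial.aeval y f ∈ O.nonunits) →
    ¬ IsAbhyankarPlace O (algebraMap k K).fieldRange ⊤ →
    ¬ (∃ d : ℕ, d < n ∧ SepDenseBelow k O d) → ¬ ToricDenseBelow k O e → ¬ KHTopBelow k O c →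
    ¬ KeyChainTopBelow k O → ¬ HenselKeyChainTopBelow k O → ¬ GaloisHenselDescentDatum k O →
    ¬ TameQuotientLU.TameEquivariantLUAbove k O →
    DecompositionFieldLUAbove k O → RelLocalUniformization k K O

/-- THE LAW DECIDES THE CELL PIECE outright, for all parameters (no port, no hypothesis, no `TheoremD`).
[folklore] -/
theorem nonKHToricArchLUKeyHenselDescentQuotDecCell_holds (e c n : ℕ) :
    NonKHToricArchLUKeyHenselDescentQuotDecCell e c n :=
  fun _ _ _ _ _ _ _ _ _ _ _ _ _ _ _ _ _ _ _ _ hD => relLU_of_decompositionFieldLUAbove hD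

/-- **DECIDED PIECE, WITNESS CURRENCY** (tag DECIDED — `nonKHToricArchLUKeyHenselDescentQuotDecWCell_holds`; WEAKER
than the root): the located residual of g25 restricted to the DECOMPOSITION-WITNESS CELL (row 202's cell). -/
def NonKHToricArchLUKeyHenselDescentQuotDecWCell (e c n : ℕ) : Prop :=
  ∀ p : ℕ, p.Prime → ∀ (k K : Type) [Field k] [CharP k p] [Field K] [Algebra k K],
    Algebra.trdeg k K ≤ n → ∀ O : ValuationSubring K, Nonempty O.valuation.RankOne →
    (∀ y ∈ O, ∃ f : Polynomial k, f ≠ 0 ∧ Polynomial.aeval y f ∈ O.nonunits) →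
    ¬ IsAbhyankarPlace O (algebraMap k K).fieldRange ⊤ →
    ¬ (∃ d : ℕ, d < n ∧ SepDenseBelow k O d) → ¬ ToricDenseBelow k O e → ¬ KHTopBelow k O c →
    ¬ KeyChainTopBelow k O → ¬ HenselKeyChainTopBelow k O → ¬ GaloisHenselDescentDatum k O →
    ¬ TameQuotientLU.TameEquivariantLUAbove k O →
    DecWitnessLUAbove k O → RelLocalUniformization k K O

/-- THE WITNESS LAW DECIDES THE WITNESS CELL PIECE outright (no port, no fact binder). [folklore] -/
theorem nonKHToricArchLUKeyHenselDescentQuotDecWCell_holds (e c n : ℕ) :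
    NonKHToricArchLUKeyHenselDescentQuotDecWCell e c n :=
  fun _ _ _ _ _ _ _ _ _ _ _ _ _ _ _ _ _ _ _ _ hD => relLU_of_decWitnessLUAbove hD

/-- **NEW LOCATED RESIDUAL `R27`** (tag UNDECIDED · WEAKER than the root · located at `(e, c, n) = (3, 3, 4)`):
the located residual OFF the key-chain, Hensel, descent, tame-quotient AND BOTH DECOMPOSITION-DESCENT cells —
for NO finite Hensel layer `K ≤ K′ ≤ K(η) ⊆ K^h` are the normalized base changes of the normal models of `K`
uniformizations of `(K′, O_E ∩ K′)` (structure currency), and for NO finite separable top do the models of `K`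
carry standard-étale witnesses with `K`-rational residues making them regular upstairs (witness currency,
row 202).  UNMATCHED CLAUSES (exhaustiveness bookkeeping, row 202 RISK 3, 0-weight): the g25/g26 cells require
residues IN `k` (`κ(O′) = k`) while this family only has `κ(O) | k` algebraic; the decomposition cells carry no
residue-FIELD clause (only `K`-rational residues of the witnesses); the inert unramified layer `K^h ⊊ K^{sh}`
(residue extension) is NOT consumed (NEXT-g28 (W-inert)). -/
def NonKHToricArchLUKeyHenselDescentQuotDec (e c n : ℕ) : Prop :=
  ∀ p : ℕ, p.Prime → ∀ (k K : Type) [Field k] [CharP k p] [Field K] [Algebra k K],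
    Algebra.trdeg k K ≤ n → ∀ O : ValuationSubring K, Nonempty O.valuation.RankOne →
    (∀ y ∈ O, ∃ f : Polynomial k, f ≠ 0 ∧ Polynomial.aeval y f ∈ O.nonunits) →
    ¬ IsAbhyankarPlace O (algebraMap k K).fieldRange ⊤ →
    ¬ (∃ d : ℕ, d < n ∧ SepDenseBelow k O d) → ¬ ToricDenseBelow k O e → ¬ KHTopBelow k O c →
    ¬ KeyChainTopBelow k O → ¬ HenselKeyChainTopBelow k O → ¬ GaloisHenselDescentDatum k O →
    ¬ TameQuotientLU.TameEquivariantLUAbove k O →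
    ¬ DecompositionFieldLUAbove k O → ¬ DecWitnessLUAbove k O → RelLocalUniformization k K O

/-- Dropping the extra negated hypotheses. [folklore] -/
theorem nonKHToricArchLUKeyHenselDescentQuotDec_of_quot {e c n : ℕ}
    (h : NonKHToricArchLUKeyHenselDescentQuot e c n) : NonKHToricArchLUKeyHenselDescentQuotDec e c n :=
  fun p hp k K _ _ _ _ hd O h1 h0 hA hnd hnt hnk hkey hH hG hT _ _ =>
    h p hp k K hd O h1 h0 hA hnd hnt hnk hkey hH hG hT

/-- **THE DECOMPOSITION-DESCENT CUT** (kernel, exact, hypothesis-free): the g25 located residual is EQUIVALENT to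
its part off the two decomposition-descent cells — on each cell its law decides. [folklore] -/
theorem nonKHToricArchLUKeyHenselDescentQuot_iff_dec {e c n : ℕ} :
    NonKHToricArchLUKeyHenselDescentQuot e c n ↔ NonKHToricArchLUKeyHenselDescentQuotDec e c n := by
  refine ⟨nonKHToricArchLUKeyHenselDescentQuotDec_of_quot,
    fun h p hp k K _ _ _ _ hd O hr hz hA hnd hnt hnk hkey hH hG hT => ?_⟩
  by_cases hD : DecompositionFieldLUAbove k O
  · exact relLU_of_decompositionFieldLUAbove hD
  by_cases hW : DecWitnessLUAbove k O
  · exact relLU_of_decWitnessLUAbove hW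
  · exact h p hp k K hd O hr hz hA hnd hnt hnk hkey hH hG hT hD hW

/-- The EXACT re-location at the programme's parameters `(3, 3, 4)` (`R25 ↔ R27`, hypothesis-free). [folklore] -/
theorem nonKHToricArchLUKeyHenselDescentQuot334_iff_dec :
    NonKHToricArchLUKeyHenselDescentQuot 3 3 4 ↔ NonKHToricArchLUKeyHenselDescentQuotDec 3 3 4 :=
  nonKHToricArchLUKeyHenselDescentQuot_iff_dec

/-- The g23 located residual re-located in one step (`R23 ↔ R27`). [folklore] -/
theorem nonKHToricArchLUKeyHenselDescent_iff_dec {e c n : ℕ} :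
    NonKHToricArchLUKeyHenselDescent e c n ↔ NonKHToricArchLUKeyHenselDescentQuotDec e c n :=
  nonKHToricArchLUKeyHenselDescent_iff_quot.trans nonKHToricArchLUKeyHenselDescentQuot_iff_dec

/-- The TRUE residual family of g17/g20 (`NonKHToricArchLU`) re-located: off the key-chain, Hensel, descent,
tame-quotient and decomposition-descent cells. [folklore] -/
theorem nonKHToricArchLU_iff_dec {e c n : ℕ} :
    NonKHToricArchLU e c n ↔ NonKHToricArchLUKeyHenselDescentQuotDec e c n :=
  nonKHToricArchLU_iff_quot.trans nonKHToricArchLUKeyHenselDescentQuot_iff_dec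

/-- The new residual follows from the root outright (it is a WEAKER piece). [folklore] -/
theorem nonKHToricArchLUKeyHenselDescentQuotDec_of_root (hS : _root_.ResolutionOfSingularities) (e c n : ℕ) :
    NonKHToricArchLUKeyHenselDescentQuotDec e c n :=
  nonKHToricArchLUKeyHenselDescentQuotDec_of_quot (nonKHToricArchLUKeyHenselDescentQuot_of_root hS e c n)

/-- **`closes_dec` — ROOT BY NAME (deciding theorem of this node).**  Cossart–Piltant floor (print) + CJS-2020
(named fact) + the KK05 (NC)+(V) ascent Π₁ (print) + the located residual OFF THE KEY-CHAIN, HENSEL, DESCENT,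
TAME-QUOTIENT AND DECOMPOSITION-DESCENT CELLS in transcendence degree `≥ 4` + the patching crux 0642 ⇒
`ResolutionOfSingularities`; all five cells are discharged INSIDE the kernel. [folklore] -/
theorem closes_dec (hCP : CossartPiltant2019LU3.{0}) (hCJS : CossartJannsenSaito2020Embedded.{0})
    (hAsc : KK05NCVAscent) (hN : ∀ d, 4 ≤ d → NonKHToricArchLUKeyHenselDescentQuotDec 3 3 d)
    (h₃ : Valuative.PatchingRel) : _root_.ResolutionOfSingularities :=
  closes_quot hCP hCJS hAsc (fun d hd => nonKHToricArchLUKeyHenselDescentQuot_iff_dec.2 (hN d hd)) h₃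

/-- Root-level summary: modulo floor + CJS + Π₁ + 0642 the ROOT is EQUIVALENT to the residual family off the five
cells. [folklore] -/
theorem root_iff_dec_sigma (hCP : CossartPiltant2019LU3.{0})
    (hCJS : CossartJannsenSaito2020Embedded.{0}) (hAsc : KK05NCVAscent) (h₃ : Valuative.PatchingRel) :
    _root_.ResolutionOfSingularities ↔ ∀ d, 4 ≤ d → NonKHToricArchLUKeyHenselDescentQuotDec 3 3 d := by
  rw [root_iff_quot_sigma hCP hCJS hAsc h₃]
  exact forall₂_congr fun d _ => nonKHToricArchLUKeyHenselDescentQuot_iff_dec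

end Cut

end Summit.ResolutionOfSingularities.ResolutionOfSingularities.Theorems.DecompositionDescentLU

end
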